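import Literature.AnabelianGeometry.AbsoluteAnabelian.AbsAnabProp121viiSub
import Literature.NumberTheory.GaloisRepresentations.CyclicLayerCarry
import HarnessLib

/-!
# [AbsAnab] Prop 1.2.1 (vii), sub-DAG row L06 — part 1: the canonical class `κ_n(π) ∪ χ` is the
# cyclic class `−(χ, π)` under the Kummer map (Serre, *Local Fields* XIV §1 Prop. 2–3)

Proof-only companion of `AbsAnabProp121viiSub.lean` (abc-iut cell, sub-DAG
`plan/L4/SUBDAG-AbsAnab-Prop121vii.md`, statements holder abc-iut-w5-d198; row L06
`ExistsUniqueInvariantMap` held by abc-iut-w5-d201; this is its first file).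
S. Mochizuki, *The Absolute Anabelian Geometry of Hyperbolic Curves* (2004) [AbsAnab],
Prop 1.2.1 (vii) p. 11: the residue map of local class field theory; its characterisation at level
`n` (`Prop121vii.IsInvariantMap`) is through the class `κ_n(π) ∪ χ ∈ H²(G_K, μ_n)` — `κ_n(π)` the
Kummer class of a uniformiser, `χ` the unramified character with `χ(Frob) = 1`, viewed as the
crossed homomorphism `σ ↦ (χ σ)·id ∈ μ_n^∨(1)`.

* `Prop121vii.scalarCocycle ψ` — for a cyclic character `ψ : G_K → ℤ/n` (tree
  `CyclicCharacter`), the continuous crossed homomorphism `σ ↦ (m ↦ (ψ σ)·m)` with values in the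
  Tate dual `μ_n^∨(1) = Hom(μ_n, μ_n)` (on which `G_K` acts trivially on scalars).
* `Prop121vii.cohomologyMap_kummerι_cupProduct_δ₀_scalar` — **the cochain identity**
  `Kummer(κ_n(u) ∪ g) = −κ_ψ(u)` in `H²(G_K, K̄ˣ)`: for any crossed homomorphism `g` with
  `g σ = (ψ σ)·id`, any `G_K`-invariant `u ∈ K̄ˣ`, the image of the cup product (evaluation pairing
  `μ_n × μ_n^∨(1) → μ_n`, `tateDualPairing`) of the Kummer class `δ₀ u` with `[g]` under
  `H²(μ_n) → H²(K̄ˣ)` is minus the tree's cyclic class `cyclicClass ψ (units K) u = [c_ψ ⊗ u]`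
  (Serre XIV §1 Prop. 2 "`(χ, b) = b ∪ δχ`"): the cup-product cocycle
  `(σ, τ) ↦ (ψ τ)·(σ w − w)` (`w` an `n`-th root of `u`) plus the carry cocycle
  `(σ, τ) ↦ c_ψ(σ, τ)·u` is the coboundary of `σ ↦ (ψ σ)·w`.

Pure cochain algebra over the tree's continuous cohomology (`ContinuousH2`, `CyclicLayerCarry`,
`ContinuousCohomologyConnecting`); the pattern is the tree's `kummerTwo_cupProduct_eq_cyclicClass`
(`DualityLineOne.lean`, the other pairing order, hence the opposite sign).  HONEST FRAMING: classical
homological algebra; nothing here bears on [IUTchIII] Cor. 3.12.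

## References
* [SerreLocalFields1979] J.-P. Serre, *Local Fields*, GTM 67 (1979), XIV §1 Prop. 2, Prop. 3.
* [MochizukiAbsAnab2004] S. Mochizuki, *The absolute anabelian geometry of hyperbolic curves* (2004),
  Prop 1.2.1 (vii) p. 11.
-/

noncomputable section

universe u

namespace Literature.AnabelianGeometry.AbsoluteAnabelian

open Field Function
open Literature.NumberTheory.GaloisRepresentations
open Literature.NumberTheory.GaloisRepresentations.DiscreteGaloisModule

namespace Prop121vii

section Scalar

variable (K : Type u) [Field K] {n : ℕ}

/-- Reduction of an integer multiple modulo `n` on an `n`-torsion element: `a.val • m` only depends on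
`a ∈ ℤ/n` additively, `(a + b).val • m = a.val • m + b.val • m` when `n • m = 0`. [folklore] -/
private theorem val_add_zsmul {M : Type*} [AddCommGroup M] [NeZero n] (a b : ZMod n) (m : M)
    (hm : (n : ℤ) • m = 0) :
    (((a + b).val : ℤ)) • m = ((a.val : ℤ)) • m + ((b.val : ℤ)) • m := by
  have hs : (a.val + b.val : ℕ) = (a + b).val + n * ((a.val + b.val) / n) := by
    rw [ZMod.val_add, Nat.mod_add_div]
  have hz : ((a.val : ℤ)) + ((b.val : ℤ)) =
      (((a + b).val : ℤ)) + (((a.val + b.val) / n : ℕ) : ℤ) * (n : ℤ) := by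
    rw [mul_comm]; exact_mod_cast hs
  rw [← add_smul, hz, add_smul, mul_smul, hm, smul_zero, add_zero]

/-- Every element of the additive carrier of `μ_n(K̄)` is killed by `n`. [folklore] -/
private theorem zsmul_toAdditive_eq_zero (m : MuCarrier K n) :
    (n : ℤ) • (MuCarrier.toAdditive m) = 0 := by
  rw [← map_zsmul, zsmul_muCarrier_eq_zero, map_zero]

/-- The scalar endomorphism `m ↦ a.val • m` of `μ_n(K̄)` as an element of the Tate dual
`μ_n^∨(1) = Hom(μ_n, μ_n)`. [cite: SerreLocalFields1979, XIV §1] -/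
def scalarEnd (a : ZMod n) : TateDual K (MuCarrier K n) n :=
  (zsmulAddGroupHom (a.val : ℤ) : Additive (rootsOfUnity n (AlgebraicClosure K)) →+ _).comp
    (MuCarrier.toAdditive (K := K) (n := n)).toAddMonoidHom

/-- Unfolding `scalarEnd`. [cite: SerreLocalFields1979, XIV §1] -/
@[simp] theorem scalarEnd_apply (a : ZMod n) (m : MuCarrier K n) :
    scalarEnd K a m = ((a.val : ℤ)) • MuCarrier.toAdditive m := rfl

/-- `scalarEnd` is additive in `a` (since `μ_n` is `n`-torsion). [cite: SerreLocalFields1979, XIV §1] -/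
theorem scalarEnd_add [NeZero n] (a b : ZMod n) : scalarEnd K (a + b) = scalarEnd K a + scalarEnd K b := by
  refine TateDual.ext fun m => ?_
  change ((((a + b).val : ℤ)) • MuCarrier.toAdditive m) =
    ((a.val : ℤ)) • MuCarrier.toAdditive m + ((b.val : ℤ)) • MuCarrier.toAdditive m
  exact val_add_zsmul a b _ (zsmul_toAdditive_eq_zero K m)

/-- `scalarEnd 0 = 0`. [cite: SerreLocalFields1979, XIV §1] -/
@[simp] theorem scalarEnd_zero : scalarEnd K (0 : ZMod n) = 0 := by
  refine TateDual.ext fun m => ?_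
  change (((0 : ZMod n).val : ℤ)) • MuCarrier.toAdditive m = 0
  rw [ZMod.val_zero, Nat.cast_zero, zero_smul]

variable [Finite (MuCarrier K n)]

/-- `G_K` acts trivially on the scalar endomorphisms of `μ_n` (the Galois action on `μ_n` is by group
automorphisms, which commute with multiplication by integers). [cite: SerreLocalFields1979, XIV §1] -/
theorem tateDual_scalarEnd (σ : absoluteGaloisGroup K) (a : ZMod n) :
    (mu K n).tateDual n σ (scalarEnd K a) = scalarEnd K a := by
  refine TateDual.ext fun m => ?_
  rw [tateDual_apply_apply_apply, scalarEnd_apply, scalarEnd_apply]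
  change mu K n σ (((a.val : ℤ)) • (mu K n σ⁻¹ m)) = ((a.val : ℤ)) • m
  rw [map_zsmul, ← Module.End.mul_apply, ← map_mul, mul_inv_cancel, map_one, Module.End.one_apply]

variable {K} in
/-- **The crossed homomorphism `σ ↦ (ψ σ)·id ∈ μ_n^∨(1)`** attached to a cyclic character
`ψ : G_K → ℤ/n` (in particular to the normalised unramified character of
`Prop121vii.IsNormalizedUnramifiedCocycle`): continuous, and a `1`-cocycle because `G_K` acts trivially
on scalar endomorphisms. [cite: SerreLocalFields1979, XIV §1] -/
def scalarCocycle [NeZero n] (ψ : CyclicCharacter (absoluteGaloisGroup K) n) :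
    contOneCocycles ((mu K n).tateDual n).toTopRep :=
  ⟨⟨fun σ => scalarEnd K (ψ σ),
    (continuous_of_discreteTopology (f := fun a : ZMod n => scalarEnd K a)).comp ψ.continuous⟩,
    fun σ τ => by
      change scalarEnd K (ψ (σ * τ)) = scalarEnd K (ψ σ) +
        ((mu K n).tateDual n).toTopRep.ρ σ (scalarEnd K (ψ τ))
      rw [ContinuousRep.toTopRep_ρ_apply, tateDual_scalarEnd, ψ.map_mul, scalarEnd_add]⟩

variable {K} in
/-- Unfolding `scalarCocycle`. [cite: SerreLocalFields1979, XIV §1] -/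
@[simp] theorem scalarCocycle_apply [NeZero n] (ψ : CyclicCharacter (absoluteGaloisGroup K) n)
    (σ : absoluteGaloisGroup K) (m : MuCarrier K n) :
    (scalarCocycle ψ).1 σ m = (((ψ σ).val : ℤ)) • MuCarrier.toAdditive m := rfl

end Scalar

/-! ### The cochain identity `Kummer(κ_n(u) ∪ g) = −κ_ψ(u)` -/

section Identity

variable {K : Type u} [Field K] {n : ℕ} [NeZero n] [Finite (MuCarrier K n)]

/-- The linear-combination identity behind the cochain computation: with `n · carry = a + b − c`,
`b·(σw − w) + carry·(n·w) = b·σw − c·w + a·w`. [folklore] -/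
private theorem carry_identity {M : Type*} [AddCommGroup M] (w sw : M) (a b c : ℕ) (carry q : ℤ)
    (h : q * carry = a + b - c) :
    (b : ℤ) • (sw - w) + carry • (q • w) = (b : ℤ) • sw - ((c : ℤ) • w) + (a : ℤ) • w := by
  rw [smul_smul, mul_comm, h, sub_smul, add_smul, smul_sub]
  abel

/-- **The cochain identity** `Kummer(κ_n(u) ∪ g) = −κ_ψ(u)` **in `H²(G_K, K̄ˣ)`**: for a cyclic
character `ψ : G_K → ℤ/n`, a crossed homomorphism `g : G_K → μ_n^∨(1)` with `g σ = (ψ σ)·id`, and a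
`G_K`-invariant `u ∈ K̄ˣ` (Kummer class `δ₀ u ∈ H¹(G_K, μ_n)` from the tree's Kummer sequence
`isSES_kummer`), the image under `H²(μ_n) → H²(K̄ˣ)` of the cup product `δ₀ u ∪ [g]` for the
evaluation pairing `μ_n × μ_n^∨(1) → μ_n` equals minus the cyclic class `κ_ψ(u) = [c_ψ ⊗ u]`: with
`w` an `n`-th root of `u`, the cocycle `(σ, τ) ↦ (ψ τ)·(σ w − w)` plus the carry cocycle
`(σ, τ) ↦ c_ψ(σ, τ)·u` is the coboundary of `σ ↦ (ψ σ)·w`.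
[cite: SerreLocalFields1979, XIV §1 Prop. 2] -/
theorem cohomologyMap_kummerι_cupProduct_δ₀_scalar
    (ψ : CyclicCharacter (absoluteGaloisGroup K) n)
    (g : contOneCocycles ((mu K n).tateDual n).toTopRep)
    (hg : ∀ (σ : absoluteGaloisGroup K) (m : MuCarrier K n),
      g.1 σ m = (((ψ σ).val : ℤ)) • MuCarrier.toAdditive m)
    (u : (units K).toTopRep.ρ.invariants) :
    haveI : CompactSpace (absoluteGaloisGroup K) := absoluteGaloisGroup_compactSpace K
    cohomologyMap (kummerι K n) 2
        (((mu K n).tateDualPairing n).cupProduct ((isSES_kummer K n (NeZero.pos n)).δ₀ u)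
          (oneCocycleClass _ g)) =
      - cyclicClass ψ (units K) u := by
  haveI : CompactSpace (absoluteGaloisGroup K) := absoluteGaloisGroup_compactSpace K
  have hn : 0 < n := NeZero.pos n
  -- an `n`-th root `w` of `u`
  obtain ⟨w, hw⟩ := (isSES_kummer K n hn).surjective (u : UnitsCarrier K)
  have hwu : (n : ℤ) • w = (u : UnitsCarrier K) := by rw [← kummerπ_hom_apply]; exact hw
  have hwinv : (kummerπ K n).hom w ∈ (units K).toTopRep.ρ.invariants := by rw [hw]; exact u.2
  rw [(isSES_kummer K n hn).δ₀_apply_eq u w hw, ContPairing.cupProduct_oneCocycleClass_eq_twoCocycleClass,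
    cyclicClass_apply, cohomologyMap_twoCocycleClass, ← twoCocycleClass_neg, ← sub_eq_zero,
    ← twoCocycleClass_sub, sub_neg_eq_add, twoCocycleClass_eq_zero_iff]
  -- the coboundary witness `σ ↦ (ψ σ) · w`
  refine ⟨⟨fun σ => (((ψ σ).val : ℤ)) • w,
    (continuous_of_discreteTopology (f := fun a : ZMod n => ((a.val : ℤ)) • w)).comp ψ.continuous⟩,
    fun σ τ => ?_⟩
  -- the cup-product side, explicitly
  have hK : (contTwoCocycles.pullback (ContinuousMonoidHom.id _) (resIdHom (kummerι K n))
      (((mu K n).tateDualPairing n).cupCocycle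
        ((isSES_kummer K n hn).δ₀Cocycle w hwinv) g)).1 (σ, τ) =
      (((ψ τ).val : ℤ)) • (units K σ w - w) := by
    rw [pullback₂_id_resIdHom_apply, ContPairing.cupCocycle_apply_eq_smul, ContinuousRep.toTopRep_ρ_apply]
    change (kummerι K n).hom ((((mu K n).tateDualPairing n).toLin
      (((isSES_kummer K n hn).δ₀Cocycle w hwinv).1 σ)) ((mu K n).tateDual n σ (g.1 τ))) = _
    have hgτ : (mu K n).tateDual n σ (g.1 τ) = g.1 τ := by
      have e : g.1 τ = scalarEnd K (ψ τ) := TateDual.ext fun m => by rw [hg, scalarEnd_apply]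
      rw [e, tateDual_scalarEnd]
    rw [hgτ]
    change (kummerι K n).hom (g.1 τ (((isSES_kummer K n hn).δ₀Cocycle w hwinv).1 σ)) = _
    rw [hg]
    change (kummerι K n).hom ((((ψ τ).val : ℤ)) • ((isSES_kummer K n hn).δ₀Cocycle w hwinv).1 σ) = _
    rw [map_zsmul, (isSES_kummer K n hn).f_δ₀Cocycle_apply w hwinv σ]
  -- the carry side, explicitly
  have hC : (carryCocycle ψ (units K) (u : UnitsCarrier K) u.2).1 (σ, τ) =
      ψ.carryFun σ τ • ((n : ℤ) • w) := by
    rw [carryCocycle_apply, hwu]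
  change (contTwoCocycles.pullback (ContinuousMonoidHom.id _) (resIdHom (kummerι K n))
      (((mu K n).tateDualPairing n).cupCocycle ((isSES_kummer K n hn).δ₀Cocycle w hwinv) g)).1 (σ, τ) +
      (carryCocycle ψ (units K) (u : UnitsCarrier K) u.2).1 (σ, τ) =
    (units K).toTopRep.ρ σ ((((ψ τ).val : ℤ)) • w) - (((ψ (σ * τ)).val : ℤ)) • w +
      (((ψ σ).val : ℤ)) • w
  rw [hK, hC, ContinuousRep.toTopRep_ρ_apply, map_zsmul]
  exact carry_identity w (units K σ w) _ _ _ _ _ (ψ.natCast_mul_carryFun σ τ)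

end Identity

end Prop121vii

end Literature.AnabelianGeometry.AbsoluteAnabelian

end
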